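import Summits.BirchSwinnertonDyer.BirchSwinnertonDyer.Theses.EisensteinPrimes
import Summits.BirchSwinnertonDyer.Rank1Residual.X1.MuLambda
import Summits.BirchSwinnertonDyer.BirchSwinnertonDyer.Theorems.KatoDescentPotSupersingularReducibleFineSelmerMuZero
import Literature.NumberTheory.EllipticCurves.Rank1Residual.EulerLossCarrier
import Literature.NumberTheory.EllipticCurves.Rank1Residual.MuLambdaCarriers
import Literature.NumberTheory.EllipticCurves.Kim2025.FineMainIdentitySkinnerUrban
import Literature.NumberTheory.EllipticCurves.IwasawaAlgebraProofs
import Literature.NumberTheory.EllipticCurves.TateModuleContinuityProofs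
import Literature.NumberTheory.EllipticCurves.KatoRankBoundAllPrimesSkeletonProofs
import Literature.Algebra.Module.RankOneTorsionFreeModules
import HarnessLib

/-!
# Sketch (cell bsd-eis, seat idea-g21) — the EXACT-μ LAW at a reducible prime and the typed candidates
# of the lens «fine μ = 0 is free at Eisenstein p; the μ-half of Mazur's MC is Kato's Euler system's p-primitivity»

Crux: `Summit.BirchSwinnertonDyer.BirchSwinnertonDyer.Theses.EisensteinPrimes.MazurMCOnX1RankZero`
(stmt-BirchSwinnertonDyer-19035).  Nothing here is landed; 0 `sorry`; tree imports only; no new named facts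
(the four `def … : Prop` below are CANDIDATE statements, nothing asserted).

§1  `exactLaw_heightOne` / `exactLaw_mu` — PROVED, NO `Irr(E[p])`, no image hypothesis: over every §17.13 Kato
    package `K` with an exact fine quotient `π : X ↠ Y`:
    `ℓ_𝔭(X) + ℓ_𝔭(𝐇¹/Z) = ℓ_𝔭(Λ/col(loc Z)) + ℓ_𝔭(Y)` at every height-one `𝔭`, and in `μ`-currency
    `μ(X) + μ(𝐇¹/Z) = μ(Λ/𝔠_K) + μ(Y)`, `𝔠_K := col(loc Z)` (the tree's `Kim2025.lengthAt_add_lengthAt_quotient_zeta_eq_heightOne`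
    minus its only `Irr`-consuming step `lengthAt_quotient_colLocZ_eq`).
§2  `fineMuZeroAt_of_red` — PROVED modulo the two NAMED facts already in the tree (Lim 2017 Thm 3.5, Ferrero–Washington):
    `μ(X₀(E/ℚ_∞)) = 0` at EVERY odd reducible pair, in particular on all of X1 (type A included).
§3  Typed candidates: `KatoPrimitiveOnX1RankZero` (C1), `ZetaSlackLawOnX1RankZero` (C1♮, the normalisation-free form),
    `KatoResidualNonTorsion` (C2, residual form over one package), `ZetaImageDividesAt` (C3, the one-sided Kato 16.6 (2)
    clause at `(p)` the door needs).
§4  `Door` — the typed implication `C3 → C1 → MuPartAt`; `crux_of_muPart_and_lambdaPart` (the crux BY NAME from the two halves).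
§5  (v2, 18:5xZ) THE DOORS PROVED, modulo named construction/print facts only (`exists_divisibilityInputs_fineQuotient`,
    `nonempty_iwasawaH1Data`, Lim 2017 Thm 3.5, Ferrero–Washington, Wuthrich 2014 Thm 16):
    `muPartAt_of_zetaSlackLaw` and `zetaSlackLaw_of_muPartAt` — **C1♮ ⟺ the μ-half `MuPartAt` on X1 ∩ {r_an = 0}**;
    `muPartAt_of_zetaImageDivides_of_eulerLossZero` / `door` — **C3 ∧ C1 ⟹ the μ-half** (`Door` holds);
    `crux_of_zetaSlackLaw_and_lambdaPart` — C1♮ ∧ λ-half ⟹ the crux decl by name.  v2 also re-types C1♮ over packages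
    with an exact fine quotient and drops v1's membership hypothesis `G₁ ∈ 𝔠_K` (which made it vacuous-or-too-strong).
§6  (v3, 18:44Z) S3 PROVED both ways: for `𝐇¹ ↪ Λ` (Kato 12.4 (2)) and `Z ≠ 0`,
    `KatoResidualNonTorsion K ↔ μ(𝐇¹/Z) = 0` (`katoResidualNonTorsion_iff_eulerLoss_eq_zero`), via the key lemma
    `lengthAt_quotient_eq_mu_of_minimal`: `length_{(p)}(Λ/J)` = the minimal `p`-content on `J ∖ 0`.
    (v4, 18:53Z) the embedding hypothesis is DISCHARGED from the named fact `Kato2004.thm12_4` (f.g. torsion-free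
    rank-`≤ 1` modules over a domain embed in `R`: Kaplansky §15 + clearing denominators):
    `katoResidualNonTorsion_iff_eulerLoss_eq_zero_of_thm12_4 (h12 : Kato2004.thm12_4) (hκ) (hγ) (K) (hZ : K.Z ≠ ⊥)`.
-/

noncomputable section

open scoped Classical MatrixGroups ModularForm NumberField
open CongruenceSubgroup WeierstrassCurve Field
open Literature.NumberTheory.GaloisRepresentations
open Literature.NumberTheory.EllipticCurves Literature.NumberTheory.EllipticCurves.ModularForms
open Literature.NumberTheory.EllipticCurves.Kato2004
open Literature.NumberTheory.EllipticCurves.Kato2004.EulerSystemValues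
open Literature.NumberTheory.EllipticCurves.Rank1Residual
open Literature.NumberTheory.IwasawaTheory
open Summit.BirchSwinnertonDyer.Rank1Residual.X1.MuLambda (MuPartAt LambdaPartAt)
open Summit.BirchSwinnertonDyer.BirchSwinnertonDyer.Theorems.Rank1ResidualX1Defs (MazurMainConjecture)
open Module IwasawaAlgebra

namespace Summit.BirchSwinnertonDyer.BirchSwinnertonDyer.Cruxes.MazurMCOnX1RankZero.FineExactMu

universe u

/-! ## §1 The exact law over a §17.13 package — reducible-safe -/

section Law

variable {p : ℕ} [Fact p.Prime] {W : WeierstrassCurve ℚ} [W.IsElliptic] [W.IsGloballyMinimal]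
  [ContinuousSMul ℤ_[p] (W.tateModule p)] {N : ℕ} [NeZero N] {f : CuspForm (Gamma0 N) 2}
  {κ : ZpExtension ℚ p} {γ : absoluteGaloisGroup ℚ}
  {I : IwasawaH1Data W p κ γ} {D : W.SelmerDualData κ γ}
  {Y : Type u} [AddCommGroup Y] [Module (IwasawaAlgebra p) Y]

omit [NeZero N] in
/-- **Exact law at every height-one prime, no `Irr(E[p])`:**
`ℓ_𝔭(X) + ℓ_𝔭(𝐇¹/Z) = ℓ_𝔭(Λ/col(loc Z)) + ℓ_𝔭(Y)` for a §17.13 package `K` and an exact fine quotient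
`π : X ↠ Y` (`ker π = im toX`).  Kato's skeleton identity with its two finite terms killed at height one
(Prop. 17.11: `coker col` finite; (17.13.4): `𝐇²_loc` finite) and `ℓ_𝔭(Y) = ℓ_𝔭(𝐇²)`.
[cite: Kato2004Asterisque, §17.13 (pp. 279–280), Prop. 17.11 (p. 277)] -/
theorem exactLaw_heightOne (K : DivisibilityInputs W p f κ γ I D)
    (π : D.X →ₗ[IwasawaAlgebra p] Y) (hπs : Function.Surjective π) (hπ : Function.Exact K.toX π)
    (𝔭 : PrimeSpectrum (IwasawaAlgebra p)) (h𝔭 : 𝔭.asIdeal.height = 1) :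
    lengthAt (IwasawaAlgebra p) D.X 𝔭 + lengthAt (IwasawaAlgebra p) (I.H ⧸ K.Z) 𝔭 =
      lengthAt (IwasawaAlgebra p) (IwasawaAlgebra p ⧸ (K.Z.map K.loc).map K.col) 𝔭 +
        lengthAt (IwasawaAlgebra p) Y 𝔭 := by
  haveI := K.finite_coker_col
  haveI := K.finite_H2loc
  haveI : Finite (LinearMap.range K.ε) := Finite.of_injective _ Subtype.val_injective
  have h := Kato2004.lengthAt_skeleton_identity K.loc K.loc_injective K.toX K.δ K.ε K.exact_P
    K.exact_X K.exact_H2 K.col K.col_injective K.Z 𝔭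
  rw [Kim2025.lengthAt_eq_zero_of_finite_heightOne (IwasawaAlgebra p ⧸ LinearMap.range K.col) 𝔭 h𝔭,
    Kim2025.lengthAt_eq_zero_of_finite_heightOne (LinearMap.range K.ε) 𝔭 h𝔭, add_zero, add_zero,
    ← Kim2025.lengthAt_fine_eq_lengthAt_H2_heightOne K π hπs hπ 𝔭 h𝔭] at h
  exact h

omit [NeZero N] in
/-- The package's `G` (`ι G = pⁿ · L_p(f, α)`) lies in the zeta image ideal `𝔠_K = col(loc Z)`. -/
theorem G_mem_colLocZ (K : DivisibilityInputs W p f κ γ I D) : K.G ∈ (K.Z.map K.loc).map K.col := by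
  rw [← Submodule.map_comp]; exact K.pow_mem

omit [NeZero N] in
/-- **Exact law in `μ`-currency, no `Irr(E[p])`:** `μ(X) + μ(𝐇¹/Z) = μ(Λ/𝔠_K) + μ(Y)` with
`𝔠_K = col(loc Z) ∋ G ≠ 0` (`X` f.g. torsion, `L_p(f,α) ≠ 0`).  Read with `μ(Y) = μ(X₀) = 0` (§2) this is
`μ_alg + δ_Z = μ(Λ/𝔠_K)`: the algebraic `μ` and the Euler loss `δ_Z := μ(𝐇¹/Z)` add up to the `μ` of the
zeta IMAGE — the analytic side enters only through `𝔠_K`. [cite: Kato2004Asterisque, §17.13 (p. 280)]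
[cite: Washington1997, §13.2] -/
theorem exactLaw_mu (K : DivisibilityInputs W p f κ γ I D)
    (hL : padicLFunction f (unitRoot W p : ℚ_[p]) ≠ 0)
    (π : D.X →ₗ[IwasawaAlgebra p] Y) (hπs : Function.Surjective π) (hπ : Function.Exact K.toX π)
    [Module.Finite (IwasawaAlgebra p) D.X] (hDt : D.IsTorsion) :
    muInvariant p D.X + muInvariant p (I.H ⧸ K.Z) =
      muInvariant p (IwasawaAlgebra p ⧸ (K.Z.map K.loc).map K.col) + muInvariant p Y := by
  let 𝔭 : PrimeSpectrum (IwasawaAlgebra p) := ⟨augIdealP p, isPrime_augIdealP_holds p⟩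
  have h𝔭1 : 𝔭.asIdeal.height = 1 := height_augIdealP_holds p
  have hA := exactLaw_heightOne K π hπs hπ 𝔭 h𝔭1
  have hG0 : K.G ≠ 0 := by
    intro h0
    have := K.ιG_eq
    rw [h0, map_zero, eq_comm, mul_eq_zero] at this
    rcases this with h | h
    · have hp0 : (p : ℚ_[p]) ≠ 0 := by exact_mod_cast (Fact.out : p.Prime).ne_zero
      exact pow_ne_zero K.n hp0 (PowerSeries.C_injective (h.trans (map_zero _).symm))
    · exact hL h
  have hby : Module.IsTorsionBy (IwasawaAlgebra p)
      (IwasawaAlgebra p ⧸ (K.Z.map K.loc).map K.col) K.G :=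
    (Module.isTorsionBy_quotient_iff _ K.G).mpr fun y ↦ by
      rw [smul_eq_mul]; exact Ideal.mul_mem_right y _ (G_mem_colLocZ K)
  have hXfin : lengthAt (IwasawaAlgebra p) D.X 𝔭 ≠ ⊤ := lengthAt_ne_top_of_isTorsion p _ hDt 𝔭 rfl
  have hCfin : lengthAt (IwasawaAlgebra p) (IwasawaAlgebra p ⧸ (K.Z.map K.loc).map K.col) 𝔭 ≠ ⊤ :=
    Module.lengthAt_ne_top_of_isTorsionBy hG0 hby 𝔭 h𝔭1.le
  have hYle : lengthAt (IwasawaAlgebra p) Y 𝔭 ≤ lengthAt (IwasawaAlgebra p) D.X 𝔭 :=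
    lengthAt_le_of_surjective π hπs 𝔭
  have hYfin : lengthAt (IwasawaAlgebra p) Y 𝔭 ≠ ⊤ := ne_top_of_le_ne_top hXfin hYle
  have hZfin : lengthAt (IwasawaAlgebra p) (I.H ⧸ K.Z) 𝔭 ≠ ⊤ := by
    refine ne_top_of_le_ne_top (WithTop.add_ne_top.mpr ⟨hCfin, hYfin⟩) ?_
    exact le_trans le_add_self hA.le
  obtain ⟨x, hx⟩ := ENat.ne_top_iff_exists.mp hXfin
  obtain ⟨m, hm⟩ := ENat.ne_top_iff_exists.mp hCfin
  obtain ⟨y, hy⟩ := ENat.ne_top_iff_exists.mp hYfin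
  obtain ⟨d, hd⟩ := ENat.ne_top_iff_exists.mp hZfin
  rw [← hx, ← hm, ← hy, ← hd] at hA
  have hA' : x + d = m + y := by exact_mod_cast hA
  have hμX : muInvariant p D.X = x := by
    rw [muInvariant_eq_toNat_lengthAt p _ 𝔭 rfl, ← hx, ENat.toNat_coe]
  have hμY : muInvariant p Y = y := by
    rw [muInvariant_eq_toNat_lengthAt p _ 𝔭 rfl, ← hy, ENat.toNat_coe]
  have hμZ : muInvariant p (I.H ⧸ K.Z) = d := by
    rw [muInvariant_eq_toNat_lengthAt p _ 𝔭 rfl, ← hd, ENat.toNat_coe]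
  have hμC : muInvariant p (IwasawaAlgebra p ⧸ (K.Z.map K.loc).map K.col) = m := by
    rw [muInvariant_eq_toNat_lengthAt p _ 𝔭 rfl, ← hm, ENat.toNat_coe]
  rw [hμX, hμZ, hμC, hμY]
  exact hA'

end Law

/-! ## §2 Fine `μ = 0` is FREE at a reducible prime (Lim 2017 Thm 3.5 + Ferrero–Washington over the abelian
Borel field; tree theorem `ReducibleFineSelmerMuZero.fineSelmerDual_moduleFinite_of_not_irreducible`) -/

section Fine

open Literature.NumberTheory.EllipticCurves.Lim2017
open Summit.BirchSwinnertonDyer.BirchSwinnertonDyer.Theorems.ReducibleFineSelmerMuZero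

/-- **Statement (A) — hence `μ(X₀(E/ℚ_∞)) = 0` for EVERY dual fine datum — at every odd reducible pair**,
type A included: `ℚ(E[p])` is a `p`-extension of the abelian Borel field `ℚ(φ, ωφ⁻¹)` (Ferrero–Washington
there, Iwasawa 1973 up, Lim 2017 Thm 3.5 / Coates–Sujatha Thm 3.4).  Modulo the two named facts.
[cite: Lim2017FineSelmer, Thm. 3.5] [cite: CoatesSujatha2005, Thm. 3.4, Cor. 3.6]
[cite: FerreroWashington1979, main theorem] -/
theorem conjAAt_of_red
    (hLim : thm35_fineSelmerDual_moduleFinite_of_classicalMuVanishes_of_le_divisionField)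
    (hFW : ferreroWashington1979_classicalMuVanishes)
    (W : WeierstrassCurve ℚ) [W.IsElliptic] (p : ℕ) [Fact p.Prime] (hp : p ≠ 2)
    (hred : ¬ W.HasIrreducibleModPGaloisRep p) : ConjAAt W p :=
  fun κ hκ ↦ fineSelmerDual_moduleFinite_of_not_irreducible hLim hFW W p hp hred κ hκ

/-- `μ(X₀) = 0` pointwise at every odd reducible pair (modulo the two named facts). -/
theorem fineMuZeroAt_of_red
    (hLim : thm35_fineSelmerDual_moduleFinite_of_classicalMuVanishes_of_le_divisionField)
    (hFW : ferreroWashington1979_classicalMuVanishes)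
    (W : WeierstrassCurve ℚ) [W.IsElliptic] (p : ℕ) [Fact p.Prime] (hp : p ≠ 2)
    (hred : ¬ W.HasIrreducibleModPGaloisRep p) : FineMuZeroAt W p :=
  (conjAAt_of_red hLim hFW W p hp hred).fineMuZeroAt

/-- On class X1 (`2 < p ∧ Red ∧ …`): `μ(X₀(E/ℚ_∞)) = 0` (modulo the two named facts). -/
theorem fineMuZeroAt_of_classX1
    (hLim : thm35_fineSelmerDual_moduleFinite_of_classicalMuVanishes_of_le_divisionField)
    (hFW : ferreroWashington1979_classicalMuVanishes)
    (W : WeierstrassCurve ℚ) [W.IsElliptic] [W.IsGloballyMinimal] (p : ℕ) [Fact p.Prime]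
    (hX1 : ClassX1 W p) : FineMuZeroAt W p :=
  fineMuZeroAt_of_red hLim hFW W p (by have := hX1.1; omega) hX1.2.1

end Fine

/-! ## §3 The typed candidates (nothing asserted) -/

section Candidates

/-- **C1 `KatoPrimitiveOnX1RankZero` — on X1 ∩ {r_an = 0}, every §17.13 Kato package is Euler-primitive at
`(p)`: `μ(𝐇¹_Γ(T_pE) / Z) = 0`** (the tree carrier `EulerLossZeroAt`, pointed at the crux's class).  By §1–§2 and
Kato–Wuthrich this implies the `μ`-half `MuPartAt` of the crux (door §4, given the one-sided image clause C3),
with NO appeal to `μ_an(E_ét) = 0` (Greenberg Conj. 1.11, open).  WHY IT MIGHT FAIL: lattice normalisation —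
for a member `W` whose Kato image `𝔠_K` is strictly smaller than `(ϖ_W·L_p(f))` at `(p)` the law forces
`δ_Z = e′ > 0` even when `MuPartAt` holds (see C1♮ for the normalisation-free form).
[cite: Kato2004Asterisque, Thm. 12.5 (4), Thm. 12.6 (p. 222), §17.13 (p. 280)] -/
def KatoPrimitiveOnX1RankZero : Prop :=
  ∀ (W : WeierstrassCurve ℚ) [W.IsElliptic] [W.IsGloballyMinimal] (p : ℕ) [Fact p.Prime]
    [ContinuousSMul ℤ_[p] (W.tateModule p)],
    ClassX1 W p → W.analyticRank = 0 → EulerLossZeroAt W p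

/-- **C1♮ `ZetaSlackLawOnX1RankZero` — the normalisation-free form: the Euler loss is at most the image
slack** (v2: stated over §17.13 packages WITH an exact fine quotient `π : X ↠ X₀`, and with NO membership
hypothesis on `G₁` — v1 asked `G₁ ∈ 𝔠_K`, which made the law vacuous-or-too-strong).  For every such package
over an X1 ∩ {r_an = 0} pair, every `ϖ` with `ϖ·Ω_E = Ω⁺_f` and every `G₁ ∈ Λ` with `ι G₁ = ϖ·L_p(f,α)`:
`μ(𝐇¹/Z) + μ(Λ/(G₁)) ≤ μ(Λ/𝔠_K)` («`δ_Z ≤ e′`», `e′ := μ(Λ/𝔠_K) − μ_an`).  By the exact law (§1) and fine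
`μ = 0` (§2) this is EQUIVALENT to `MuPartAt W p` on X1 ∩ {r_an = 0} — BOTH directions PROVED in §5
(`muPartAt_of_zetaSlackLaw`, `zetaSlackLaw_of_muPartAt`, modulo the named construction/print facts listed
there); the reverse inequality `δ_Z ≥ e′` is Kato–Wuthrich `μ_alg ≤ μ_an`.  The `μ`-half of Mazur's MC at
X1, restated inside `(𝐇¹, Z, Col, L_p)` with no Selmer group.
[cite: Kato2004Asterisque, §17.13 (p. 280), Thm. 16.6 (p. 271)] -/
def ZetaSlackLawOnX1RankZero : Prop :=
  ∀ (W : WeierstrassCurve ℚ) [W.IsElliptic] [W.IsGloballyMinimal] (p : ℕ) [Fact p.Prime]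
    [ContinuousSMul ℤ_[p] (W.tateModule p)],
    ClassX1 W p → W.analyticRank = 0 →
    ∀ (κ : ZpExtension ℚ p) (γ : Field.absoluteGaloisGroup ℚ),
      κ.IsCyclotomic → κ.IsTopGenerator γ → IsCyclotomicVariable p γ →
    ∀ [NeZero (W.conductorNorm ℤ)] (f : CuspForm (Gamma0 (W.conductorNorm ℤ)) 2),
      IsNewformOf W f → ∀ (ϖ : ℚ), (ϖ : ℝ) * W.realPeriodRat = plusPeriod f →
    ∀ (I : IwasawaH1Data W p κ γ) (D : W.SelmerDualData κ γ) (K : DivisibilityInputs W p f κ γ I D)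
      (Y : W.FineSelmerDualData κ γ) (π : D.X →ₗ[IwasawaAlgebra p] Y.X),
      Function.Surjective π → Function.Exact K.toX π →
    ∀ (G₁ : IwasawaAlgebra p),
      iwasawaToPowerSeries p G₁ = PowerSeries.C (ϖ : ℚ_[p]) * padicLFunction f (unitRoot W p : ℚ_[p]) →
      muInvariant p (I.H ⧸ K.Z) + muInvariant p (IwasawaAlgebra p ⧸ Ideal.span {G₁}) ≤
        muInvariant p (IwasawaAlgebra p ⧸ (K.Z.map K.loc).map K.col)

variable {p : ℕ} [Fact p.Prime] {W : WeierstrassCurve ℚ} [W.IsElliptic] [W.IsGloballyMinimal]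
  [ContinuousSMul ℤ_[p] (W.tateModule p)] {N : ℕ} [NeZero N] {f : CuspForm (Gamma0 N) 2}
  {κ : ZpExtension ℚ p} {γ : absoluteGaloisGroup ℚ}
  {I : IwasawaH1Data W p κ γ} {D : W.SelmerDualData κ γ}

omit [NeZero N] in
/-- **C2 `KatoResidualNonTorsion K` — the residual form of `δ_Z = 0` over ONE package: Kato's zeta module is
not torsion modulo `p`.**  Some `z ∈ Z` has image in `𝐇¹/p𝐇¹` (an `𝔽_p⟦T⟧`-module of rank one, the odd
character `ψ = ωφ⁻¹` of `E[p]^{ss}` carrying the rank) that no `s ∈ Λ ∖ (p)` kills.  For `𝐇¹` torsion-free of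
rank one this is `μ(𝐇¹/Z) = 0` verbatim; it is the first checkable form of «the residual Kato class
`z̄ ∈ H¹_Iw(ℚ_∞, E[p]) → H¹_Iw(ℚ_∞, 𝔽_p(ψ)) ≅ 𝔽_p⟦T⟧·c ⊕ (finite)` has a non-zero coefficient `A_E(T)`».
[cite: Kato2004Asterisque, Thm. 12.4 (2) (p. 221), Thm. 12.6 (p. 222)] -/
def KatoResidualNonTorsion (K : DivisibilityInputs W p f κ γ I D) : Prop :=
  ∃ z ∈ K.Z, ∀ s : IwasawaAlgebra p, s ∉ augIdealP p →
    s • z ∉ augIdealP p • (⊤ : Submodule (IwasawaAlgebra p) I.H)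

/-- **C3 `ZetaImageDividesAt W p` — the one-sided Kato 16.6 (2) clause at `(p)` the door needs (image slack
`e′ ≥ 0`): every Coleman image of a localised zeta element is divisible, after localisation at `(p)`, by the
Néron-normalised `p`-adic `L`-function `ϖ·L_p(f,α)`.**  Printed as an IDENTITY of elements for Kato's lattice
`V_ℤ(f)` (Thm. 16.6 (2): `Col(z_γ) = L_{p,γ}`; the period of `γ ∈ H₁(E′,ℤ)⁺` against a Néron differential is an
INTEGER multiple of the `f dq/q`-period, Manin/Stevens), whence divisibility for every member; the tree's package
field `image_zeta_localized` records the two-sided version under `Irr(E[p])` only.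
[cite: Kato2004Asterisque, Thm. 16.6 (2) (p. 271), 17.5 (p. 274), p. 280] -/
def ZetaImageDividesAt (W : WeierstrassCurve ℚ) [W.IsElliptic] [W.IsGloballyMinimal] (p : ℕ) [Fact p.Prime]
    [ContinuousSMul ℤ_[p] (W.tateModule p)] : Prop :=
  ∀ (κ : ZpExtension ℚ p) (γ : Field.absoluteGaloisGroup ℚ),
      κ.IsCyclotomic → κ.IsTopGenerator γ → IsCyclotomicVariable p γ →
    ∀ [NeZero (W.conductorNorm ℤ)] (f : CuspForm (Gamma0 (W.conductorNorm ℤ)) 2),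
      IsNewformOf W f → ∀ (ϖ : ℚ), (ϖ : ℝ) * W.realPeriodRat = plusPeriod f →
    ∀ (I : IwasawaH1Data W p κ γ) (D : W.SelmerDualData κ γ) (K : DivisibilityInputs W p f κ γ I D)
      (G₁ : IwasawaAlgebra p),
      iwasawaToPowerSeries p G₁ = PowerSeries.C (ϖ : ℚ_[p]) * padicLFunction f (unitRoot W p : ℚ_[p]) →
      ∃ s : IwasawaAlgebra p, s ∉ augIdealP p ∧ ∀ z ∈ K.Z, s * K.col (K.loc z) ∈ Ideal.span {G₁}

end Candidates

/-! ## §4 The door (typed; statement only — a prover's item): image clause + Euler-primitivity ⟹ the μ-half -/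

/-- **Door (to be proved): `ZetaImageDividesAt ∧ EulerLossZeroAt ⟹ MuPartAt` on X1 ∩ {r_an = 0}**, modulo the
named facts feeding §1–§2 (packages with fine quotient exist: `exists_divisibilityInputs_fineQuotient`; fine
data exist; Lim 2017; Ferrero–Washington).  Paper proof: `char X = (g)`, `ι(g·h) = ϖ L_p`; take `G₁ := g·h`;
§1 at `(p)` with `μ(Y) = 0` (§2) and `δ_Z = 0`: `μ(X) = μ(Λ/𝔠_K) ≥ μ(Λ/(g·h))` (C3: `𝔠_K ⊆ (g·h)` at `(p)`),
i.e. `mu g ≥ mu (g·h)`. [cite: Kato2004Asterisque, §17.13 (p. 280)] -/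
def Door : Prop :=
  Kato2004.exists_divisibilityInputs_fineQuotient →
  Lim2017.thm35_fineSelmerDual_moduleFinite_of_classicalMuVanishes_of_le_divisionField →
  ferreroWashington1979_classicalMuVanishes →
  ∀ (W : WeierstrassCurve ℚ) [W.IsElliptic] [W.IsGloballyMinimal] (p : ℕ) [Fact p.Prime]
    [ContinuousSMul ℤ_[p] (W.tateModule p)],
    ClassX1 W p → W.analyticRank = 0 → ZetaImageDividesAt W p → EulerLossZeroAt W p → MuPartAt W p

/-- Shape check: the crux decl is reachable by name from `MuPartAt ∧ LambdaPartAt` through the tree's split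
(granted Wuthrich's Thm. 16), so a proof of `Door` + C3 + C1 reduces the crux to its `λ`-half on the nose.
[cite: Wuthrich2014, Thm. 16] -/
theorem crux_of_muPart_and_lambdaPart
    (hW16 : Wuthrich2014.charIdeal_dvd_padicLFunction)
    (hmu : ∀ (W : WeierstrassCurve ℚ) [W.IsElliptic] [W.IsGloballyMinimal] (p : ℕ) [Fact p.Prime],
      ClassX1 W p → W.analyticRank = 0 → MuPartAt W p)
    (hlam : ∀ (W : WeierstrassCurve ℚ) [W.IsElliptic] [W.IsGloballyMinimal] (p : ℕ) [Fact p.Prime],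
      ClassX1 W p → W.analyticRank = 0 → LambdaPartAt W p) :
    Summit.BirchSwinnertonDyer.BirchSwinnertonDyer.Theses.EisensteinPrimes.MazurMCOnX1RankZero := by
  intro W _ _ p _ hX1 hr
  obtain ⟨hp2, hred, hgood, hanom, hngv⟩ := id hX1
  have hp : p ≠ 2 := by omega
  have hord : ¬ (p : ℤ) ∣ W.frobeniusTrace p := by
    intro hdvd
    have h1 : (p : ℤ) ∣ W.frobeniusTrace p - 1 := hanom.2.2
    have : (p : ℤ) ∣ 1 := by simpa using Int.dvd_sub hdvd h1
    have hp1 : (p : ℤ) ≤ 1 := Int.le_of_dvd one_pos this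
    have := (Fact.out : p.Prime).two_le
    omega
  exact (Summit.BirchSwinnertonDyer.Rank1Residual.X1.MuLambda.mazurMainConjecture_iff_muPart_and_lambdaPart
    hW16 hp hgood hord hred).mpr ⟨hmu W p hX1 hr, hlam W p hX1 hr⟩

/-! ## §5 The doors, PROVED (v2): C1♮ ⟺ the μ-half on X1 ∩ {r_an = 0}; C3 ∧ Euler-primitivity ⟹ the μ-half

Named facts consumed (all already in the tree, statement-only): `Kato2004.exists_divisibilityInputs_fineQuotient`
(§17.13 package with exact fine quotient — construction), `Kato2004.nonempty_iwasawaH1Data` (construction),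
`Lim2017.thm35_…`, `ferreroWashington1979_classicalMuVanishes` (§2), `Wuthrich2014.charIdeal_dvd_padicLFunction`
(torsion of `X` and Kato's divisibility at a reducible prime). -/

section Doors

open Summit.BirchSwinnertonDyer.Rank1Residual.X1
open Literature.NumberTheory.EllipticCurves.Lim2017
open Summit.BirchSwinnertonDyer.BirchSwinnertonDyer.Theorems.ReducibleFineSelmerMuZero

variable {p : ℕ} [Fact p.Prime]

/-- `μ(g) = μ(Λ/(g))`: the `p`-content of `g ≠ 0` is the local length of `Λ/(g)` at `(p)`
(`g = p^{μ(g)}·g₀`, `g₀ ∉ (p)`). [cite: Washington1997, §13.2] -/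
theorem mu_eq_muInvariant_quotient {a : IwasawaAlgebra p} (ha : a ≠ 0) :
    MuLambda.mu a = muInvariant p (IwasawaAlgebra p ⧸ Ideal.span {a}) := by
  let 𝔭 : PrimeSpectrum (IwasawaAlgebra p) := ⟨augIdealP p, isPrime_augIdealP_holds p⟩
  have h1 : 𝔭.asIdeal.height = 1 := height_augIdealP_holds p
  have hspan : Ideal.span ({a} : Set (IwasawaAlgebra p)) =
      Ideal.span {PowerSeries.C ((p : ℤ_[p]) ^ MuLambda.mu a) * MuLambda.pfree a} := by
    rw [← MuLambda.eq_C_pow_mu_mul_pfree a]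
  have hC : (PowerSeries.C ((p : ℤ_[p]) ^ MuLambda.mu a) : IwasawaAlgebra p) ≠ 0 :=
    MuLambda.C_pow_ne_zero _
  have hCmem : PowerSeries.C (p : ℤ_[p]) ∈ 𝔭.asIdeal := Ideal.mem_span_singleton_self _
  have hPnot : ¬ Ideal.span {MuLambda.pfree a} ≤ 𝔭.asIdeal := by
    rw [Ideal.span_singleton_le_iff_mem]
    intro hmem
    exact MuLambda.red_pfree_ne_zero ha ((IwasawaAlgebra.map_residue_eq_zero_iff p _).mpr hmem)
  rw [muInvariant_eq_toNat_lengthAt p _ 𝔭 rfl,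
    Module.lengthAt_eq_of_linearEquiv (Submodule.quotEquivOfEq _ _ hspan) 𝔭,
    Module.lengthAt_quotient_span_singleton_mul _ hC 𝔭, lengthAt_quotient_C_pow _ 𝔭 h1, if_pos hCmem,
    Module.lengthAt_quotient_eq_zero_of_not_le hPnot, add_zero, nsmul_one, ENat.toNat_coe]

/-- A quotient of a torsion module is torsion. [folklore] -/
theorem isTorsion_of_surjective {R : Type*} [CommRing R] {M N : Type*} [AddCommGroup M] [Module R M]
    [AddCommGroup N] [Module R N] (π : M →ₗ[R] N) (hπ : Function.Surjective π)
    (hM : Module.IsTorsion R M) : Module.IsTorsion R N := by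
  intro y
  obtain ⟨x, rfl⟩ := hπ y
  obtain ⟨a, ha⟩ := @hM x
  refine ⟨a, ?_⟩
  change (a : R) • π x = 0
  rw [← map_smul]
  change π (a • x) = 0
  rw [ha, map_zero]

/-- On X1 the prime is ordinary: `a_p ≡ 1 (mod p)` and `p ≥ 3` forbid `p ∣ a_p`. -/
theorem not_dvd_frobeniusTrace_of_classX1 {W : WeierstrassCurve ℚ} [W.IsElliptic] [W.IsGloballyMinimal]
    (hX1 : ClassX1 W p) : ¬ (p : ℤ) ∣ W.frobeniusTrace p := by
  intro hdvd
  have h1 : (p : ℤ) ∣ W.frobeniusTrace p - 1 := hX1.2.2.2.1.2.2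
  have : (p : ℤ) ∣ 1 := by simpa using Int.dvd_sub hdvd h1
  have hp1 : (p : ℤ) ≤ 1 := Int.le_of_dvd one_pos this
  have := (Fact.out : p.Prime).two_le
  omega

/-- **The law read through a generator**: over an X1 pair, for a §17.13 package `K` with exact fine quotient
and `char X = (g)`, `g ≠ 0`: `μ(g) + μ(𝐇¹/Z) = μ(Λ/𝔠_K)` (exact law §1, fine `μ = 0` §2, `μ(g) = μ(X)`).
[cite: Kato2004Asterisque, §17.13 (p. 280)] [cite: Wuthrich2014, Thm. 16] -/
theorem mu_generator_add_eulerLoss_eq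
    (hLim : thm35_fineSelmerDual_moduleFinite_of_classicalMuVanishes_of_le_divisionField)
    (hFW : ferreroWashington1979_classicalMuVanishes)
    (hW16 : Wuthrich2014.charIdeal_dvd_padicLFunction)
    {W : WeierstrassCurve ℚ} [W.IsElliptic] [W.IsGloballyMinimal] [ContinuousSMul ℤ_[p] (W.tateModule p)]
    (hX1 : ClassX1 W p) {κ : ZpExtension ℚ p} {γ : absoluteGaloisGroup ℚ}
    (hκ : κ.IsCyclotomic) (hγ : κ.IsTopGenerator γ) (hγ' : IsCyclotomicVariable p γ)
    [NeZero (W.conductorNorm ℤ)] {f : CuspForm (Gamma0 (W.conductorNorm ℤ)) 2} (hf : IsNewformOf W f)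
    {ϖ : ℚ} (hϖ : (ϖ : ℝ) * W.realPeriodRat = plusPeriod f)
    {I : IwasawaH1Data W p κ γ} {D : W.SelmerDualData κ γ} (K : DivisibilityInputs W p f κ γ I D)
    (Y : W.FineSelmerDualData κ γ) (π : D.X →ₗ[IwasawaAlgebra p] Y.X) (hπs : Function.Surjective π)
    (hπ : Function.Exact K.toX π) {g : IwasawaAlgebra p} (hg : g ≠ 0)
    (hchar : D.charIdeal = Ideal.span {g}) :
    MuLambda.mu g + muInvariant p (I.H ⧸ K.Z) =
      muInvariant p (IwasawaAlgebra p ⧸ (K.Z.map K.loc).map K.col) := by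
  obtain ⟨hp2, hred, hgood, -, -⟩ := id hX1
  have hp : p ≠ 2 := by omega
  have hord := not_dvd_frobeniusTrace_of_classX1 hX1
  obtain ⟨hDt, -⟩ := hW16 W p hp ⟨hgood, hord⟩ hred hκ hγ hγ' hf D ϖ hϖ
  haveI : Module.Finite (IwasawaAlgebra p) D.X := D.module_finite_of_isCyclotomic W κ hκ hγ
  have hL : padicLFunction f (unitRoot W p : ℚ_[p]) ≠ 0 := padicLFunction_unitRoot_ne_zero ⟨hgood, hord⟩ hf
  have hlaw := exactLaw_mu K hL π hπs hπ hDt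
  have hYfin : Module.Finite (IwasawaAlgebra p) Y.X := Module.Finite.of_surjective π hπs
  have hYt : Module.IsTorsion (IwasawaAlgebra p) Y.X := isTorsion_of_surjective π hπs hDt
  have hY0 : muInvariant p Y.X = 0 :=
    fineMuZeroAt_of_classX1 hLim hFW W p hX1 κ γ hκ hγ hγ' Y hYfin hYt
  have hμX : MuLambda.mu g = muInvariant p D.X := MuPart.mu_generator_eq_muInvariant D.X hDt hg hchar
  rw [hY0, add_zero, ← hμX] at hlaw
  exact hlaw

/-- **(⇒) The slack law gives the μ-half**: `ZetaSlackLawOnX1RankZero → (ClassX1 → r_an = 0 → MuPartAt)`,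
modulo the named facts. [cite: Kato2004Asterisque, §17.13 (p. 280)] -/
theorem muPartAt_of_zetaSlackLaw
    (hfine : Kato2004.exists_divisibilityInputs_fineQuotient) (hne : Kato2004.nonempty_iwasawaH1Data)
    (hLim : thm35_fineSelmerDual_moduleFinite_of_classicalMuVanishes_of_le_divisionField)
    (hFW : ferreroWashington1979_classicalMuVanishes)
    (hW16 : Wuthrich2014.charIdeal_dvd_padicLFunction)
    (hC : ZetaSlackLawOnX1RankZero)
    (W : WeierstrassCurve ℚ) [W.IsElliptic] [W.IsGloballyMinimal] (p : ℕ) [Fact p.Prime]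
    [ContinuousSMul ℤ_[p] (W.tateModule p)] (hX1 : ClassX1 W p) (hr : W.analyticRank = 0) :
    MuPartAt W p := by
  intro κ γ hκ hγ hγ' _ f hf ϖ hϖ D g h hchar hι
  obtain ⟨hp2, hred, hgood, -, -⟩ := id hX1
  have hp : p ≠ 2 := by omega
  have hord := not_dvd_frobeniusTrace_of_classX1 hX1
  have hgh : g * h ≠ 0 := MuLambda.mul_ne_zero_of_iota_eq hgood hord hf hϖ D hι
  have hg : g ≠ 0 := fun h0 => hgh (by rw [h0, zero_mul])
  obtain ⟨I⟩ := hne W p κ γ hκ hγ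
  obtain ⟨Y⟩ := W.nonempty_fineSelmerDualData (κ := κ) hγ
  obtain ⟨K, π, hπs, hπ⟩ := hfine W p f κ γ hp ⟨hgood, hord⟩ hκ hγ hγ' hf I D Y
  have hlaw := mu_generator_add_eulerLoss_eq hLim hFW hW16 hX1 hκ hγ hγ' hf hϖ K Y π hπs hπ hg hchar
  have hle := hC W p hX1 hr κ γ hκ hγ hγ' f hf ϖ hϖ I D K Y π hπs hπ (g * h) hι
  rw [← mu_eq_muInvariant_quotient hgh] at hle
  omega

/-- **(⇐) The μ-half gives the slack law** (over packages with exact fine quotient), modulo the named facts.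
[cite: Kato2004Asterisque, §17.13 (p. 280)] [cite: Wuthrich2014, Thm. 16] -/
theorem zetaSlackLaw_of_muPartAt
    (hLim : thm35_fineSelmerDual_moduleFinite_of_classicalMuVanishes_of_le_divisionField)
    (hFW : ferreroWashington1979_classicalMuVanishes)
    (hW16 : Wuthrich2014.charIdeal_dvd_padicLFunction)
    (hM : ∀ (W : WeierstrassCurve ℚ) [W.IsElliptic] [W.IsGloballyMinimal] (p : ℕ) [Fact p.Prime],
      ClassX1 W p → W.analyticRank = 0 → MuPartAt W p) :
    ZetaSlackLawOnX1RankZero := by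
  intro W _ _ p _ _ hX1 hr κ γ hκ hγ hγ' _ f hf ϖ hϖ I D K Y π hπs hπ G₁ hG₁
  obtain ⟨hp2, hred, hgood, -, -⟩ := id hX1
  have hp : p ≠ 2 := by omega
  have hord := not_dvd_frobeniusTrace_of_classX1 hX1
  obtain ⟨-, g', hg'mem, hι'⟩ := hW16 W p hp ⟨hgood, hord⟩ hred hκ hγ hγ' hf D ϖ hϖ
  have hg' : g' = G₁ := iwasawaToPowerSeries_injective p (hι'.trans hG₁.symm)
  obtain ⟨g, hg⟩ := (charIdeal_isPrincipal_holds p D.X).principal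
  have hchar : D.charIdeal = Ideal.span {g} := hg
  have hmem : G₁ ∈ Ideal.span {g} := by rw [← hg', ← hchar]; exact hg'mem
  obtain ⟨h, hh⟩ := Ideal.mem_span_singleton'.mp hmem
  have hG : G₁ = g * h := by rw [← hh, mul_comm]
  subst hG
  have hgh : g * h ≠ 0 := MuLambda.mul_ne_zero_of_iota_eq hgood hord hf hϖ D hG₁
  have hg0 : g ≠ 0 := fun h0 => hgh (by rw [h0, zero_mul])
  have hmu : MuLambda.mu (g * h) ≤ MuLambda.mu g :=
    hM W p hX1 hr κ γ hκ hγ hγ' f hf ϖ hϖ D g h hchar hG₁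
  have hlaw := mu_generator_add_eulerLoss_eq hLim hFW hW16 hX1 hκ hγ hγ' hf hϖ K Y π hπs hπ hg0 hchar
  rw [← mu_eq_muInvariant_quotient hgh]
  omega

/-- **Door PROVED**: `C3 ∧ C1 ⟹ μ-half` — `ZetaImageDividesAt W p → EulerLossZeroAt W p → MuPartAt W p` on
X1 ∩ {r_an = 0}, modulo the named facts (v1's `Door` plus the two construction facts `nonempty_iwasawaH1Data`,
and Wuthrich Thm. 16 for the torsion of `X`).  Proof: `μ(g) + δ_Z = μ(Λ/𝔠_K)` (law through a generator),
`δ_Z = 0` (C1), `μ(Λ/(g·h)) ≤ μ(Λ/𝔠_K)` (C3: `s·𝔠_K ⊆ (g·h)` with `s ∉ (p)`, `lengthAt_quotient_le_of_smul_mem`).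
[cite: Kato2004Asterisque, §17.13 (p. 280), Thm. 16.6 (2) (p. 271)] -/
theorem muPartAt_of_zetaImageDivides_of_eulerLossZero
    (hfine : Kato2004.exists_divisibilityInputs_fineQuotient) (hne : Kato2004.nonempty_iwasawaH1Data)
    (hLim : thm35_fineSelmerDual_moduleFinite_of_classicalMuVanishes_of_le_divisionField)
    (hFW : ferreroWashington1979_classicalMuVanishes)
    (hW16 : Wuthrich2014.charIdeal_dvd_padicLFunction)
    (W : WeierstrassCurve ℚ) [W.IsElliptic] [W.IsGloballyMinimal] (p : ℕ) [Fact p.Prime]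
    [ContinuousSMul ℤ_[p] (W.tateModule p)] (hX1 : ClassX1 W p) (_hr : W.analyticRank = 0)
    (hC3 : ZetaImageDividesAt W p) (hE : EulerLossZeroAt W p) : MuPartAt W p := by
  intro κ γ hκ hγ hγ' _ f hf ϖ hϖ D g h hchar hι
  obtain ⟨hp2, hred, hgood, -, -⟩ := id hX1
  have hp : p ≠ 2 := by omega
  have hord := not_dvd_frobeniusTrace_of_classX1 hX1
  have hgh : g * h ≠ 0 := MuLambda.mul_ne_zero_of_iota_eq hgood hord hf hϖ D hι
  have hg : g ≠ 0 := fun h0 => hgh (by rw [h0, zero_mul])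
  obtain ⟨I⟩ := hne W p κ γ hκ hγ
  obtain ⟨Y⟩ := W.nonempty_fineSelmerDualData (κ := κ) hγ
  obtain ⟨K, π, hπs, hπ⟩ := hfine W p f κ γ hp ⟨hgood, hord⟩ hκ hγ hγ' hf I D Y
  have hlaw := mu_generator_add_eulerLoss_eq hLim hFW hW16 hX1 hκ hγ hγ' hf hϖ K Y π hπs hπ hg hchar
  have hZ : muInvariant p (I.H ⧸ K.Z) = 0 := hE κ γ f hκ hγ hγ' hf I D K
  obtain ⟨s, hs, hsub⟩ := hC3 κ γ hκ hγ hγ' f hf ϖ hϖ I D K (g * h) hι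
  -- `μ(Λ/(g·h)) ≤ μ(Λ/𝔠_K)` from `s·𝔠_K ⊆ (g·h)`, `s ∉ (p)`
  let 𝔭 : PrimeSpectrum (IwasawaAlgebra p) := ⟨augIdealP p, isPrime_augIdealP_holds p⟩
  have h𝔭1 : 𝔭.asIdeal.height = 1 := height_augIdealP_holds p
  have hlen : lengthAt (IwasawaAlgebra p) (IwasawaAlgebra p ⧸ Ideal.span {g * h}) 𝔭 ≤
      lengthAt (IwasawaAlgebra p) (IwasawaAlgebra p ⧸ (K.Z.map K.loc).map K.col) 𝔭 := by
    refine Module.lengthAt_quotient_le_of_smul_mem 𝔭 hs ?_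
    intro a ha
    obtain ⟨y, hy, rfl⟩ := Submodule.mem_map.mp ha
    obtain ⟨z, hz, rfl⟩ := Submodule.mem_map.mp hy
    exact hsub z hz
  have hL : padicLFunction f (unitRoot W p : ℚ_[p]) ≠ 0 := padicLFunction_unitRoot_ne_zero ⟨hgood, hord⟩ hf
  have hG0 : K.G ≠ 0 := by
    intro h0
    have := K.ιG_eq
    rw [h0, map_zero, eq_comm, mul_eq_zero] at this
    rcases this with h' | h'
    · have hp0 : (p : ℚ_[p]) ≠ 0 := by exact_mod_cast (Fact.out : p.Prime).ne_zero
      exact pow_ne_zero K.n hp0 (PowerSeries.C_injective (h'.trans (map_zero _).symm))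
    · exact hL h'
  have hby : Module.IsTorsionBy (IwasawaAlgebra p)
      (IwasawaAlgebra p ⧸ (K.Z.map K.loc).map K.col) K.G :=
    (Module.isTorsionBy_quotient_iff _ K.G).mpr fun y ↦ by
      rw [smul_eq_mul]; exact Ideal.mul_mem_right y _ (G_mem_colLocZ K)
  have hCfin : lengthAt (IwasawaAlgebra p) (IwasawaAlgebra p ⧸ (K.Z.map K.loc).map K.col) 𝔭 ≠ ⊤ :=
    Module.lengthAt_ne_top_of_isTorsionBy hG0 hby 𝔭 h𝔭1.le
  have hμle : muInvariant p (IwasawaAlgebra p ⧸ Ideal.span {g * h}) ≤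
      muInvariant p (IwasawaAlgebra p ⧸ (K.Z.map K.loc).map K.col) := by
    rw [muInvariant_eq_toNat_lengthAt p _ 𝔭 rfl, muInvariant_eq_toNat_lengthAt p _ 𝔭 rfl]
    exact ENat.toNat_le_toNat hlen hCfin
  rw [← mu_eq_muInvariant_quotient hgh] at hμle
  omega

/-- `Door` holds granted the two extra located facts (construction of `𝐇¹_Γ`, Wuthrich Thm. 16). -/
theorem door (hne : Kato2004.nonempty_iwasawaH1Data) (hW16 : Wuthrich2014.charIdeal_dvd_padicLFunction) :
    Door :=
  fun hfine hLim hFW W _ _ p _ _ hX1 hr hC3 hE ↦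
    muPartAt_of_zetaImageDivides_of_eulerLossZero hfine hne hLim hFW hW16 W p hX1 hr hC3 hE

/-- **Net effect on the crux**: granted the named facts, `ZetaSlackLawOnX1RankZero` (the μ-half in
Euler-system form) and the λ-half `LambdaPartAt` on X1 ∩ {r_an = 0} give the crux BY NAME. -/
theorem crux_of_zetaSlackLaw_and_lambdaPart
    (hfine : Kato2004.exists_divisibilityInputs_fineQuotient) (hne : Kato2004.nonempty_iwasawaH1Data)
    (hLim : thm35_fineSelmerDual_moduleFinite_of_classicalMuVanishes_of_le_divisionField)
    (hFW : ferreroWashington1979_classicalMuVanishes)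
    (hW16 : Wuthrich2014.charIdeal_dvd_padicLFunction)
    (hC : ZetaSlackLawOnX1RankZero)
    (hlam : ∀ (W : WeierstrassCurve ℚ) [W.IsElliptic] [W.IsGloballyMinimal] (p : ℕ) [Fact p.Prime],
      ClassX1 W p → W.analyticRank = 0 → LambdaPartAt W p) :
    Summit.BirchSwinnertonDyer.BirchSwinnertonDyer.Theses.EisensteinPrimes.MazurMCOnX1RankZero :=
  crux_of_muPart_and_lambdaPart hW16
    (fun W _ _ p _ hX1 hr ↦ by
      haveI : ContinuousSMul ℤ_[p] (W.tateModule p) := TateModule.continuousSMul_padicInt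
      exact muPartAt_of_zetaSlackLaw hfine hne hLim hFW hW16 hC W p hX1 hr)
    hlam

end Doors

/-! ## §6 (S3 PROVED, both directions): residual non-torsion ⟺ no Euler loss, for `𝐇¹ ↪ Λ`

Pure `Λ`-algebra at the prime `(p)`: let `H` embed `Λ`-linearly into `Λ` (Kato Thm. 12.4 (2): `𝐇¹` is torsion
free of rank one, so `𝐇¹ ↪ 𝐇¹ ⊗ Q ≅ Q(Λ)`; clear denominators).  KEY LEMMA (`lengthAt_quotient_eq_mu_of_minimal`):
for an ideal `J ≠ 0` of `Λ`, `length_{(p)}(Λ/J)` is the MINIMAL `p`-content `μ(x)` over `0 ≠ x ∈ J`.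
(⇒) if some `z ∈ Z` is residually non-torsion (`s • z ∉ p•H` for all `s ∉ (p)`) then `μ(H/Z) = 0`: with
`J = j(H)` of minimal content `a` (at `x₀ = p^a s₀`, `s₀ ∉ (p)`), `j z = p^k·(…)` with `k > a` would give
`s₀ • z ∈ p•H`; so `k = a` and `μ(H/Λz) = length(Λ/(j z)) − length(Λ/J) = 0`.
(⇐) if `Z ≠ 0` and `μ(H/Z) = 0` then a content-minimal `z₀ ∈ Z` is residually non-torsion (contents add). -/

section ResidualForm

open Summit.BirchSwinnertonDyer.Rank1Residual.X1

variable {p : ℕ} [Fact p.Prime]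

/-- `length_{(p)}(Λ/(a)) = μ(a)` for `a ≠ 0`. [cite: Washington1997, §13.2] -/
theorem lengthAt_quotient_span_singleton_eq_mu {a : IwasawaAlgebra p} (ha : a ≠ 0) :
    lengthAt (IwasawaAlgebra p) (IwasawaAlgebra p ⧸ Ideal.span {a})
      ⟨augIdealP p, isPrime_augIdealP_holds p⟩ = (MuLambda.mu a : ℕ∞) := by
  let 𝔭 : PrimeSpectrum (IwasawaAlgebra p) := ⟨augIdealP p, isPrime_augIdealP_holds p⟩
  have h1 : 𝔭.asIdeal.height = 1 := height_augIdealP_holds p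
  have hspan : Ideal.span ({a} : Set (IwasawaAlgebra p)) =
      Ideal.span {PowerSeries.C ((p : ℤ_[p]) ^ MuLambda.mu a) * MuLambda.pfree a} := by
    rw [← MuLambda.eq_C_pow_mu_mul_pfree a]
  have hC : (PowerSeries.C ((p : ℤ_[p]) ^ MuLambda.mu a) : IwasawaAlgebra p) ≠ 0 :=
    MuLambda.C_pow_ne_zero _
  have hCmem : PowerSeries.C (p : ℤ_[p]) ∈ 𝔭.asIdeal := Ideal.mem_span_singleton_self _
  have hPnot : ¬ Ideal.span {MuLambda.pfree a} ≤ 𝔭.asIdeal := by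
    rw [Ideal.span_singleton_le_iff_mem]
    intro hmem
    exact MuLambda.red_pfree_ne_zero ha ((IwasawaAlgebra.map_residue_eq_zero_iff p _).mpr hmem)
  change lengthAt _ _ 𝔭 = _
  rw [Module.lengthAt_eq_of_linearEquiv (Submodule.quotEquivOfEq _ _ hspan) 𝔭,
    Module.lengthAt_quotient_span_singleton_mul _ hC 𝔭, lengthAt_quotient_C_pow _ 𝔭 h1, if_pos hCmem,
    Module.lengthAt_quotient_eq_zero_of_not_le hPnot, add_zero, nsmul_one]

/-- `μ(s) = 0` for `s ∉ (p)`. [folklore] -/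
theorem mu_eq_zero_of_not_mem {s : IwasawaAlgebra p} (hs : s ∉ augIdealP p) : MuLambda.mu s = 0 := by
  have hs0 : s ≠ 0 := fun h => hs (h ▸ Submodule.zero_mem _)
  by_contra hne
  apply hs
  have hdvd : PowerSeries.C (p : ℤ_[p]) ∣ PowerSeries.C ((p : ℤ_[p]) ^ MuLambda.mu s) := by
    rw [map_pow]; exact dvd_pow_self _ hne
  exact Ideal.mem_span_singleton.mpr (hdvd.trans (MuLambda.C_pow_mu_dvd hs0))

/-- A quotient map `Λ-module / A ↠ / B` for `A ≤ B` (as a linear map), and its surjectivity. [folklore] -/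
theorem mapQ_id_surjective {M : Type*} [AddCommGroup M] [Module (IwasawaAlgebra p) M]
    {A B : Submodule (IwasawaAlgebra p) M} (h : A ≤ B) :
    Function.Surjective (Submodule.mapQ A B (LinearMap.id (R := IwasawaAlgebra p) (M := M))
      (fun x hx => h hx)) := fun y ↦ by
  obtain ⟨y, rfl⟩ := Submodule.Quotient.mk_surjective _ y
  exact ⟨Submodule.Quotient.mk y, rfl⟩

/-- **Key lemma**: `length_{(p)}(Λ/J) = μ(x₀)` for a `p`-content-minimal `0 ≠ x₀ ∈ J`.
[cite: Washington1997, §13.2] -/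
theorem lengthAt_quotient_eq_mu_of_minimal {J : Submodule (IwasawaAlgebra p) (IwasawaAlgebra p)}
    {x₀ : IwasawaAlgebra p} (hx₀J : x₀ ∈ J) (hx₀0 : x₀ ≠ 0)
    (hmin : ∀ x ∈ J, x ≠ 0 → MuLambda.mu x₀ ≤ MuLambda.mu x) :
    lengthAt (IwasawaAlgebra p) (IwasawaAlgebra p ⧸ J) ⟨augIdealP p, isPrime_augIdealP_holds p⟩ =
      (MuLambda.mu x₀ : ℕ∞) := by
  let 𝔭 : PrimeSpectrum (IwasawaAlgebra p) := ⟨augIdealP p, isPrime_augIdealP_holds p⟩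
  have h1 : 𝔭.asIdeal.height = 1 := height_augIdealP_holds p
  have hCmem : PowerSeries.C (p : ℤ_[p]) ∈ augIdealP p := Ideal.mem_span_singleton_self _
  change lengthAt _ _ 𝔭 = _
  refine le_antisymm ?_ ?_
  · have hle : (Ideal.span {x₀} : Submodule (IwasawaAlgebra p) (IwasawaAlgebra p)) ≤ J := by
      rw [Ideal.span_singleton_le_iff_mem]
      exact hx₀J
    calc lengthAt _ (IwasawaAlgebra p ⧸ J) 𝔭
        ≤ lengthAt _ (IwasawaAlgebra p ⧸ Ideal.span {x₀}) 𝔭 :=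
          Module.lengthAt_le_of_surjective _ (mapQ_id_surjective hle) 𝔭
      _ = MuLambda.mu x₀ := lengthAt_quotient_span_singleton_eq_mu hx₀0
  · have hle : J ≤ (Ideal.span {PowerSeries.C ((p : ℤ_[p]) ^ MuLambda.mu x₀)} :
        Submodule (IwasawaAlgebra p) (IwasawaAlgebra p)) := by
      intro x hx
      by_cases hx0 : x = 0
      · rw [hx0]; exact Submodule.zero_mem _
      · rw [Ideal.mem_span_singleton]
        calc PowerSeries.C ((p : ℤ_[p]) ^ MuLambda.mu x₀)
            ∣ PowerSeries.C ((p : ℤ_[p]) ^ MuLambda.mu x) := by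
              rw [map_pow, map_pow]; exact pow_dvd_pow _ (hmin x hx hx0)
          _ ∣ x := MuLambda.C_pow_mu_dvd hx0
    calc (MuLambda.mu x₀ : ℕ∞)
        = lengthAt _ (IwasawaAlgebra p ⧸
            Ideal.span {PowerSeries.C ((p : ℤ_[p]) ^ MuLambda.mu x₀)}) 𝔭 := by
          rw [lengthAt_quotient_C_pow _ 𝔭 h1, if_pos hCmem, nsmul_one]
      _ ≤ lengthAt _ (IwasawaAlgebra p ⧸ J) 𝔭 :=
          Module.lengthAt_le_of_surjective _ (mapQ_id_surjective hle) 𝔭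

/-- A nonzero submodule of `Λ` has a `p`-content-minimal nonzero element. [folklore] -/
theorem exists_mu_minimal {J : Submodule (IwasawaAlgebra p) (IwasawaAlgebra p)} {y : IwasawaAlgebra p}
    (hyJ : y ∈ J) (hy0 : y ≠ 0) :
    ∃ x₀ ∈ J, x₀ ≠ 0 ∧ ∀ x ∈ J, x ≠ 0 → MuLambda.mu x₀ ≤ MuLambda.mu x := by
  classical
  have hex : ∃ n, ∃ x ∈ J, x ≠ 0 ∧ MuLambda.mu x = n := ⟨_, y, hyJ, hy0, rfl⟩
  obtain ⟨x₀, hx₀J, hx₀0, hx₀mu⟩ := Nat.find_spec hex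
  exact ⟨x₀, hx₀J, hx₀0, fun x hx hx0 => by rw [hx₀mu]; exact Nat.find_min' hex ⟨x, hx, hx0, rfl⟩⟩

/-- The exact sequence `H/Z ↪ Λ/j(Z) ↠ Λ/j(H)` for an embedding `j : H ↪ Λ`: local lengths add. [folklore] -/
theorem lengthAt_quotient_map_eq_add {H : Type*} [AddCommGroup H] [Module (IwasawaAlgebra p) H]
    (j : H →ₗ[IwasawaAlgebra p] IwasawaAlgebra p) (hj : Function.Injective j)
    (Z : Submodule (IwasawaAlgebra p) H) (𝔭 : PrimeSpectrum (IwasawaAlgebra p)) :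
    lengthAt (IwasawaAlgebra p) (IwasawaAlgebra p ⧸ Z.map j) 𝔭 =
      lengthAt (IwasawaAlgebra p) (H ⧸ Z) 𝔭 +
        lengthAt (IwasawaAlgebra p) (IwasawaAlgebra p ⧸ LinearMap.range j) 𝔭 := by
  have hZle : Z ≤ (Z.map j).comap j := Submodule.le_comap_map _ _
  have hle : Z.map j ≤ LinearMap.range j := LinearMap.map_le_range
  let f : (H ⧸ Z) →ₗ[IwasawaAlgebra p] (IwasawaAlgebra p ⧸ Z.map j) := Submodule.mapQ _ _ j hZle
  let g : (IwasawaAlgebra p ⧸ Z.map j) →ₗ[IwasawaAlgebra p] (IwasawaAlgebra p ⧸ LinearMap.range j) :=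
    Submodule.mapQ _ _ (LinearMap.id (R := IwasawaAlgebra p) (M := IwasawaAlgebra p)) (fun x hx => hle hx)
  have hf : Function.Injective f := by
    intro x y hxy
    obtain ⟨x, rfl⟩ := Submodule.Quotient.mk_surjective _ x
    obtain ⟨y, rfl⟩ := Submodule.Quotient.mk_surjective _ y
    rw [Submodule.Quotient.eq]
    have hxy' : (Submodule.Quotient.mk (j x) : IwasawaAlgebra p ⧸ Z.map j) =
        Submodule.Quotient.mk (j y) := by
      simpa [f, Submodule.mapQ_apply] using hxy
    rw [Submodule.Quotient.eq, ← map_sub] at hxy'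
    obtain ⟨w, hw, hw'⟩ := Submodule.mem_map.mp hxy'
    rw [← hj hw']
    exact hw
  have hfg : Function.Exact f g := by
    intro y
    obtain ⟨y, rfl⟩ := Submodule.Quotient.mk_surjective _ y
    constructor
    · intro hy
      have hy' : y ∈ LinearMap.range j := by
        simpa [g, Submodule.mapQ_apply, Submodule.Quotient.mk_eq_zero, Ideal.Quotient.eq_zero_iff_mem]
          using hy
      obtain ⟨x, rfl⟩ := hy'
      exact ⟨Submodule.Quotient.mk x, by simp [f, Submodule.mapQ_apply]⟩
    · rintro ⟨x, hx⟩
      obtain ⟨x, rfl⟩ := Submodule.Quotient.mk_surjective _ x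
      have hx' : (Submodule.Quotient.mk (j x) : IwasawaAlgebra p ⧸ Z.map j) = Submodule.Quotient.mk y := by
        simpa [f, Submodule.mapQ_apply] using hx
      rw [Submodule.Quotient.eq] at hx'
      have hyJ : y ∈ LinearMap.range j := by
        have : y = j x - (j x - y) := by ring
        rw [this]
        exact Submodule.sub_mem _ ⟨x, rfl⟩ (hle hx')
      simpa [g, Submodule.mapQ_apply, Submodule.Quotient.mk_eq_zero, Ideal.Quotient.eq_zero_iff_mem]
        using hyJ
  exact Module.lengthAt_eq_add_of_exact f g hf (mapQ_id_surjective hle) hfg 𝔭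

set_option maxHeartbeats 800000 in
/-- **S3 (⇒): residual non-torsion of the zeta class forces `μ(H/Z) = 0`**, for any `Λ`-module `H`
embedded in `Λ` (e.g. Kato's `𝐇¹`, torsion free of rank one).
[cite: Kato2004Asterisque, Thm. 12.4 (2) (p. 221)] [cite: Washington1997, §13.2] -/
theorem muInvariant_quotient_eq_zero_of_residualNonTorsion
    {H : Type*} [AddCommGroup H] [Module (IwasawaAlgebra p) H]
    (j : H →ₗ[IwasawaAlgebra p] IwasawaAlgebra p) (hj : Function.Injective j)
    {Z : Submodule (IwasawaAlgebra p) H} {z : H} (hz : z ∈ Z)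
    (hC2 : ∀ s : IwasawaAlgebra p, s ∉ augIdealP p →
      s • z ∉ augIdealP p • (⊤ : Submodule (IwasawaAlgebra p) H)) :
    muInvariant p (H ⧸ Z) = 0 := by
  classical
  let 𝔭 : PrimeSpectrum (IwasawaAlgebra p) := ⟨augIdealP p, isPrime_augIdealP_holds p⟩
  have hCmem : PowerSeries.C (p : ℤ_[p]) ∈ augIdealP p := Ideal.mem_span_singleton_self _
  have h1not : (1 : IwasawaAlgebra p) ∉ augIdealP p := fun h =>
    (isPrime_augIdealP_holds p).ne_top ((Ideal.eq_top_iff_one _).mpr h)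
  have hz0 : z ≠ 0 := fun h0 =>
    hC2 1 h1not (by rw [h0, smul_zero]; exact Submodule.zero_mem _)
  have hζ0 : j z ≠ 0 := fun h => hz0 (hj (by rw [map_zero]; exact h))
  have hζJ : j z ∈ LinearMap.range j := ⟨z, rfl⟩
  obtain ⟨x₀, hx₀J, hx₀0, hmin⟩ := exists_mu_minimal hζJ hζ0
  obtain ⟨a, ha⟩ : ∃ a, MuLambda.mu x₀ = a := ⟨_, rfl⟩
  obtain ⟨k, hk⟩ : ∃ k, MuLambda.mu (j z) = k := ⟨_, rfl⟩
  have hak : a ≤ k := by rw [← ha, ← hk]; exact hmin _ hζJ hζ0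
  have hx₀eq : x₀ = PowerSeries.C ((p : ℤ_[p]) ^ a) * MuLambda.pfree x₀ := by
    rw [← ha]; exact MuLambda.eq_C_pow_mu_mul_pfree x₀
  have hζeq : j z = PowerSeries.C ((p : ℤ_[p]) ^ k) * MuLambda.pfree (j z) := by
    rw [← hk]; exact MuLambda.eq_C_pow_mu_mul_pfree (j z)
  have hJ : lengthAt (IwasawaAlgebra p) (IwasawaAlgebra p ⧸ LinearMap.range j) 𝔭 = a := by
    rw [← ha]; exact lengthAt_quotient_eq_mu_of_minimal hx₀J hx₀0 hmin
  -- `k = a`, by the residual hypothesis applied to `s₀ := pfree x₀ ∉ (p)`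
  have hka : k = a := by
    by_contra hne
    have hlt : a < k := lt_of_le_of_ne hak (Ne.symm hne)
    have hs : MuLambda.pfree x₀ ∉ augIdealP p := fun hmem =>
      MuLambda.red_pfree_ne_zero hx₀0 ((IwasawaAlgebra.map_residue_eq_zero_iff p _).mpr hmem)
    obtain ⟨h₀, hh₀⟩ := hx₀J
    have hpow : (PowerSeries.C ((p : ℤ_[p]) ^ k) : IwasawaAlgebra p) =
        PowerSeries.C (p : ℤ_[p]) * PowerSeries.C ((p : ℤ_[p]) ^ (k - 1 - a)) *
          PowerSeries.C ((p : ℤ_[p]) ^ a) := by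
      rw [← map_mul, ← map_mul, ← pow_succ', ← pow_add, show k - 1 - a + 1 + a = k by omega]
    have key : MuLambda.pfree x₀ • z =
        PowerSeries.C (p : ℤ_[p]) •
          ((PowerSeries.C ((p : ℤ_[p]) ^ (k - 1 - a)) * MuLambda.pfree (j z)) • h₀) := by
      apply hj
      rw [map_smul, map_smul, map_smul, hh₀, smul_eq_mul, smul_eq_mul, smul_eq_mul]
      conv_lhs => rw [hζeq]
      conv_rhs => rw [hx₀eq]
      rw [hpow]
      ring
    exact hC2 _ hs (by rw [key]; exact Submodule.smul_mem_smul hCmem Submodule.mem_top)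
  -- `length(Λ/(j z)) = length(H/Λz) + length(Λ/J)`, i.e. `k = ℓ + a`, so `ℓ = 0`
  have hadd := lengthAt_quotient_map_eq_add j hj (Submodule.span (IwasawaAlgebra p) {z}) 𝔭
  rw [Submodule.map_span, Set.image_singleton] at hadd
  change lengthAt _ (IwasawaAlgebra p ⧸ Ideal.span {j z}) 𝔭 = _ at hadd
  rw [lengthAt_quotient_span_singleton_eq_mu hζ0, hk, hJ, hka] at hadd
  have hℓ : lengthAt (IwasawaAlgebra p) (H ⧸ Submodule.span (IwasawaAlgebra p) {z}) 𝔭 = 0 :=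
    WithTop.add_right_cancel (ENat.coe_ne_top a) (hadd.symm.trans (zero_add _).symm)
  -- `H/Λz ↠ H/Z`
  have hzZ : Submodule.span (IwasawaAlgebra p) {z} ≤ Z := by
    rw [Submodule.span_le, Set.singleton_subset_iff]; exact hz
  have hZ : lengthAt (IwasawaAlgebra p) (H ⧸ Z) 𝔭 = 0 := by
    refine nonpos_iff_eq_zero.mp ?_
    calc lengthAt _ (H ⧸ Z) 𝔭 ≤ lengthAt _ (H ⧸ Submodule.span (IwasawaAlgebra p) {z}) 𝔭 :=
          Module.lengthAt_le_of_surjective _ (mapQ_id_surjective hzZ) 𝔭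
      _ = 0 := hℓ
  rw [muInvariant_eq_toNat_lengthAt p _ 𝔭 rfl, hZ, ENat.toNat_zero]

set_option maxHeartbeats 800000 in
/-- **S3 (⇐): no Euler loss forces a residually non-torsion zeta element** — for `H ↪ Λ` and `Z ≠ 0` with
`μ(H/Z) = 0`, a `p`-content-minimal `z₀ ∈ Z` satisfies `s • z₀ ∉ p•H` for every `s ∉ (p)`.
[cite: Kato2004Asterisque, Thm. 12.4 (2) (p. 221)] [cite: Washington1997, §13.2] -/
theorem residualNonTorsion_of_muInvariant_quotient_eq_zero
    {H : Type*} [AddCommGroup H] [Module (IwasawaAlgebra p) H]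
    (j : H →ₗ[IwasawaAlgebra p] IwasawaAlgebra p) (hj : Function.Injective j)
    {Z : Submodule (IwasawaAlgebra p) H} (hZ : Z ≠ ⊥) (hμ : muInvariant p (H ⧸ Z) = 0) :
    ∃ z ∈ Z, ∀ s : IwasawaAlgebra p, s ∉ augIdealP p →
      s • z ∉ augIdealP p • (⊤ : Submodule (IwasawaAlgebra p) H) := by
  classical
  let 𝔭 : PrimeSpectrum (IwasawaAlgebra p) := ⟨augIdealP p, isPrime_augIdealP_holds p⟩
  have h1 : 𝔭.asIdeal.height = 1 := height_augIdealP_holds p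
  haveI : Module.Finite (IwasawaAlgebra p) H := Module.Finite.of_injective j hj
  -- a nonzero `z₁ ∈ Z`; content-minimal elements `x₀ ∈ J = j(H)` and `j z₀ ∈ j(Z)`
  obtain ⟨z₁, hz₁Z, hz₁0⟩ := (Submodule.ne_bot_iff Z).mp hZ
  have hjz₁0 : j z₁ ≠ 0 := fun h => hz₁0 (hj (by rw [map_zero]; exact h))
  obtain ⟨x₀, hx₀J, hx₀0, hminJ⟩ := exists_mu_minimal (J := LinearMap.range j) ⟨z₁, rfl⟩ hjz₁0
  obtain ⟨y₀, hy₀JZ, hy₀0, hminZ⟩ :=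
    exists_mu_minimal (J := Z.map j) (Submodule.mem_map_of_mem hz₁Z) hjz₁0
  obtain ⟨z₀, hz₀Z, rfl⟩ := Submodule.mem_map.mp hy₀JZ
  refine ⟨z₀, hz₀Z, fun s hs hmem => ?_⟩
  -- lengths: `length(Λ/j(Z)) = length(H/Z) + length(Λ/J)`, `length(H/Z) = 0`
  have hJ := lengthAt_quotient_eq_mu_of_minimal hx₀J hx₀0 hminJ
  have hJZ := lengthAt_quotient_eq_mu_of_minimal hy₀JZ hy₀0 hminZ
  have hadd := lengthAt_quotient_map_eq_add j hj Z 𝔭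
  have hby : Module.IsTorsionBy (IwasawaAlgebra p) (H ⧸ Z) (j z₁) :=
    (Module.isTorsionBy_quotient_iff _ _).mpr fun x ↦ by
      have : j z₁ • x = j x • z₁ := hj (by rw [map_smul, map_smul, smul_eq_mul, smul_eq_mul, mul_comm])
      rw [this]; exact Z.smul_mem _ hz₁Z
  have hfin : lengthAt (IwasawaAlgebra p) (H ⧸ Z) 𝔭 ≠ ⊤ :=
    Module.lengthAt_ne_top_of_isTorsionBy hjz₁0 hby 𝔭 h1.le
  have hℓ : lengthAt (IwasawaAlgebra p) (H ⧸ Z) 𝔭 = 0 := by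
    rw [muInvariant_eq_toNat_lengthAt p _ 𝔭 rfl, ENat.toNat_eq_zero] at hμ
    exact hμ.resolve_right hfin
  change lengthAt _ _ 𝔭 = _ at hJ hJZ
  rw [hℓ, zero_add, hJ, hJZ, Nat.cast_inj] at hadd
  -- `hadd : mu (j z₀) = mu x₀`; now `s • z₀ ∈ p•H` gives `s * j z₀ = C p * w`, `0 ≠ w ∈ J`
  have hs0 : s ≠ 0 := fun h => hs (h ▸ Submodule.zero_mem _)
  have hmem' : j (s • z₀) ∈ (augIdealP p • (⊤ : Submodule (IwasawaAlgebra p) H)).map j :=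
    Submodule.mem_map_of_mem hmem
  rw [Submodule.map_smul'', Submodule.map_top, augIdealP, Submodule.ideal_span_singleton_smul,
    Submodule.mem_smul_pointwise_iff_exists] at hmem'
  obtain ⟨w, hwJ, hw⟩ := hmem'
  rw [map_smul, smul_eq_mul, smul_eq_mul] at hw
  -- `hw : C p * w = s * j z₀`
  have hw0 : w ≠ 0 := by
    intro h0
    rw [h0, mul_zero] at hw
    exact (mul_ne_zero hs0 hy₀0) hw.symm
  have hup : MuLambda.mu (s * j z₀) = MuLambda.mu x₀ := by
    rw [MuLambda.mu_mul hs0 hy₀0, mu_eq_zero_of_not_mem hs, zero_add, hadd]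
  have hdw : PowerSeries.C ((p : ℤ_[p]) ^ MuLambda.mu x₀) ∣ w :=
    calc PowerSeries.C ((p : ℤ_[p]) ^ MuLambda.mu x₀)
        ∣ PowerSeries.C ((p : ℤ_[p]) ^ MuLambda.mu w) := by
          rw [map_pow, map_pow]; exact pow_dvd_pow _ (hminJ w hwJ hw0)
      _ ∣ w := MuLambda.C_pow_mu_dvd hw0
  have hlow : MuLambda.mu x₀ + 1 ≤ MuLambda.mu (s * j z₀) := by
    refine MuLambda.le_mu_of_C_pow_dvd (mul_ne_zero hs0 hy₀0) ?_
    rw [← hw, pow_succ', map_mul]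
    exact mul_dvd_mul_left _ hdw
  omega

variable {W : WeierstrassCurve ℚ} [W.IsElliptic] [W.IsGloballyMinimal]
  [ContinuousSMul ℤ_[p] (W.tateModule p)] {N : ℕ} [NeZero N] {f : CuspForm (Gamma0 N) 2}
  {κ : ZpExtension ℚ p} {γ : absoluteGaloisGroup ℚ}
  {I : IwasawaH1Data W p κ γ} {D : W.SelmerDualData κ γ}

omit [NeZero N] in
/-- **C2 ⟺ (C1 over one package)**: for Kato's `𝐇¹` embedded in `Λ` (torsion free of rank one, Kato Thm. 12.4
(2)) and a nonzero zeta module, `KatoResidualNonTorsion K ↔ μ(𝐇¹/Z) = 0`.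
[cite: Kato2004Asterisque, Thm. 12.4 (2) (p. 221), §17.13 (p. 280)] -/
theorem katoResidualNonTorsion_iff_eulerLoss_eq_zero (K : DivisibilityInputs W p f κ γ I D)
    (jH : I.H →ₗ[IwasawaAlgebra p] IwasawaAlgebra p) (hjH : Function.Injective jH) (hZ : K.Z ≠ ⊥) :
    KatoResidualNonTorsion K ↔ muInvariant p (I.H ⧸ K.Z) = 0 :=
  ⟨fun ⟨_, hz, hC2⟩ ↦ muInvariant_quotient_eq_zero_of_residualNonTorsion jH hjH hz hC2,
    residualNonTorsion_of_muInvariant_quotient_eq_zero jH hjH hZ⟩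

/-- **Embedding `𝐇¹ ↪ Λ`, general algebra**: a finitely generated torsion-free module of rank `≤ 1` over a
domain `R` embeds `R`-linearly into `R` (Kaplansky: `M ≅` a fractional ideal `⊆ K`; clear the finitely many
denominators). [cite: Kaplansky1954, §15 (PDF p. 51)] -/
theorem exists_injective_linearMap_of_isTorsionFree_of_rank_le_one
    {R : Type*} [CommRing R] [IsDomain R] {M : Type*} [AddCommGroup M] [Module R M]
    [Module.Finite R M] [Module.IsTorsionFree R M] (hrk : Module.rank R M ≤ 1) :
    ∃ j : M →ₗ[R] R, Function.Injective j := by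
  classical
  -- Kaplansky's rank-`≤ 1` form
  have hrk' : ∀ a b : M, ∃ r s : R, (r ≠ 0 ∨ s ≠ 0) ∧ r • a = s • b := by
    intro a b
    by_contra h
    push_neg at h
    have hli : LinearIndependent R ![a, b] := by
      refine LinearIndependent.pair_iff.2 fun s t hst => ?_
      by_contra hne
      have hor : s ≠ 0 ∨ -t ≠ 0 := by
        rcases not_and_or.mp hne with hs | ht
        · exact Or.inl hs
        · exact Or.inr (neg_ne_zero.mpr ht)
      exact h s (-t) hor (by rw [neg_smul, eq_neg_iff_add_eq_zero, hst])
    have h2 := hli.fintype_card_le_finrank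
    have h1 : Module.finrank R M ≤ 1 := Module.finrank_le_of_rank_le (by exact_mod_cast hrk)
    simp only [Fintype.card_fin] at h2
    omega
  by_cases hM : ∀ x : M, x = 0
  · exact ⟨0, fun a b _ => by rw [hM a, hM b]⟩
  push_neg at hM
  obtain ⟨x, hx⟩ := hM
  obtain ⟨φ, hφ, -⟩ :=
    Literature.Algebra.Module.exists_injective_linearMap_fractionRing_of_rank_le_one hrk' hx
  -- a common denominator `b` for `φ` on a finite generating set, hence on all of `M`
  obtain ⟨S, hS⟩ := Module.Finite.fg_top (R := R) (M := M)
  obtain ⟨b, hb⟩ := IsLocalization.exist_integer_multiples (nonZeroDivisors R) S (fun m ↦ φ m)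
  have hall : ∀ m : M, IsLocalization.IsInteger R ((b : R) • φ m) := by
    intro m
    have hm : m ∈ Submodule.span R (S : Set M) := by rw [hS]; trivial
    induction hm using Submodule.span_induction with
    | mem m hm => exact hb m hm
    | zero => rw [map_zero, smul_zero]; exact IsLocalization.isInteger_zero
    | add u v _ _ hu hv => rw [map_add, smul_add]; exact IsLocalization.isInteger_add hu hv
    | smul r u _ hu => rw [map_smul, smul_comm]; exact IsLocalization.isInteger_smul hu
  let ψ : M →ₗ[R] FractionRing R := (b : R) • φ
  have hψ : ∀ m, ψ m ∈ LinearMap.range (Algebra.linearMap R (FractionRing R)) := fun m ↦ by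
    obtain ⟨r, hr⟩ := hall m
    exact ⟨r, hr⟩
  have hψinj : Function.Injective ψ := (injective_iff_map_eq_zero ψ).2 fun m hm ↦ by
    rw [LinearMap.smul_apply, smul_eq_zero] at hm
    exact (injective_iff_map_eq_zero φ).1 hφ m (hm.resolve_left (nonZeroDivisors.coe_ne_zero b))
  have hinj : Function.Injective (Algebra.linearMap R (FractionRing R)) :=
    IsFractionRing.injective R (FractionRing R)
  let e := LinearEquiv.ofInjective (Algebra.linearMap R (FractionRing R)) hinj
  refine ⟨e.symm.toLinearMap ∘ₗ (ψ.codRestrict _ hψ), ?_⟩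
  exact e.symm.injective.comp fun m m' hmm' ↦ hψinj (congrArg Subtype.val hmm')

/-- **Kato Thm. 12.4 (2) ⟹ `𝐇¹ ↪ Λ`** (the embedding hypothesis of this section, discharged from the named fact).
[cite: Kato2004Asterisque, Thm. 12.4 (2) (p. 221)] -/
theorem exists_injective_linearMap_of_thm12_4 (h12 : Kato2004.thm12_4) (hκ : κ.IsCyclotomic)
    (hγ : κ.IsTopGenerator γ) (I : IwasawaH1Data W p κ γ) :
    ∃ j : I.H →ₗ[IwasawaAlgebra p] IwasawaAlgebra p, Function.Injective j := by
  obtain ⟨hfin, ⟨htf, hrk⟩, -⟩ := h12 W p κ γ hκ hγ I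
  haveI := hfin
  haveI := htf
  exact exists_injective_linearMap_of_isTorsionFree_of_rank_le_one hrk.le

omit [NeZero N] in
/-- **C2 ⟺ (C1 over one package), mod the named fact Kato Thm. 12.4 (2)**: for a cyclotomic package with
`Z ≠ 0`, `KatoResidualNonTorsion K ↔ μ(𝐇¹/Z) = 0`. [cite: Kato2004Asterisque, Thm. 12.4 (2) (p. 221), §17.13 (p. 280)] -/
theorem katoResidualNonTorsion_iff_eulerLoss_eq_zero_of_thm12_4 (h12 : Kato2004.thm12_4)
    (hκ : κ.IsCyclotomic) (hγ : κ.IsTopGenerator γ) (K : DivisibilityInputs W p f κ γ I D) (hZ : K.Z ≠ ⊥) :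
    KatoResidualNonTorsion K ↔ muInvariant p (I.H ⧸ K.Z) = 0 := by
  obtain ⟨jH, hjH⟩ := exists_injective_linearMap_of_thm12_4 h12 hκ hγ I
  exact katoResidualNonTorsion_iff_eulerLoss_eq_zero K jH hjH hZ

end ResidualForm


end Summit.BirchSwinnertonDyer.BirchSwinnertonDyer.Cruxes.MazurMCOnX1RankZero.FineExactMu

end
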